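import Literature.MathematicalPhysics.QuantumFieldTheory.DiagonalLatticeClustering
import HarnessLib

/-!
# Stub `stub_gapTransfer` of line `birth`
(crux `Summit.QuantumFields.QCD.Theses.GapBuysCauchyRate.ConvergentOSClosure`,
item stmt-QuantumFields-11525, route route-QuantumFields-GapBuysCauchyRate)

**The continuum species gap of a labelled limit family WITHOUT rotation invariance (E1).**
The tree theorems `OSData.truncated_eq_zero_left/right`, `OSData.hasMassGap_of_csBound_span`
(`MassGapFromSpanClustering`), `OSData.hasMassGap_of_diagBound` and
`OSData.hasMassGap_of_tendsto_of_diagBound` (`MassGapFromDiagonalClustering`) are stated for a full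
`T : OSData ι d` but their proofs only use E0-normalisation, translation invariance on `⁰𝒮`,
reflection positivity (through `OSReconstructionNoE1`) and the cluster property.  This file ports
them verbatim to a bare labelled family `S : LabelledSchwingerFamily ι (EuclideanSpace ℝ (Fin d))`
with exactly these four hypotheses (`…_noE1`), and reads off the registered stub: convergence of
the lattice QCD `n`-point functions to `S` on off-diagonal real product tensors plus species
diagonal clustering `sch.HasSpeciesDiagClustering Δ` give `S.HasMassGap Δ`.

Proof (Osterwalder–Schrader 1973, §4.1; Glimm–Jaffe 1987, Thm. 6.1.3): inside the OS Hilbert space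
of `S` the diagonal quantity is `⟨v, e^{−tH} v⟩` for `v = Ψ_P − ⟨Ω, Ψ_P⟩Ω`; log-convexity with
infinite horizon self-improves a bound `C e^{−Δt}` to `‖v‖² e^{−Δt}`, the improved bound passes to
spans, Cauchy–Schwarz gives the span bound with the reflection-positive norms, and ordered-wedge
density (`IsTimeOrdered.mem_closure_span_slabOrderedProducts`) extends it to all time-ordered test
functions; degree `0` in either slot is E4 along a spatial direction plus translation invariance.
References: Osterwalder–Schrader, CMP 31 (1973) §4.1; Glimm–Jaffe, *Quantum Physics* (1987) §6.1
Thm. 6.1.3; Osterwalder–Seiler, Ann. Phys. 110 (1978) §§2–4.  No definitions, no named facts.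
-/

noncomputable section

open scoped BigOperators Topology SchwartzMap ComplexConjugate InnerProductSpace
open MeasureTheory Filter Complex Set
open Literature.MathematicalPhysics.AQFT Literature.MathematicalPhysics.QuantumLattice
  Literature.MathematicalPhysics.QuantumFieldTheory

namespace Summit.QuantumFields.QCD.Theorems.ConvergentOSClosure

variable {ι : Type} {d : ℕ} [NeZero d] {n m : ℕ}

/-- **Degree zero, left slot, no E1.** For `F` in no variable, `G` time-ordered, `t ≥ 0` and a
spatial direction `a ≠ 0`: `𝔖_{0+m}(ΘF* ⊗ T_t G) = 𝔖₀(ΘF*) 𝔖ₘ(G)` — E4 along `a` for the pair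
`(F, T_t G)` is a constant sequence (the empty slot carries no variable), and translation invariance
on `⁰𝒮` removes `T_t`. -/
theorem truncated_eq_zero_left_noE1 (S : LabelledSchwingerFamily ι (EuclideanSpace ℝ (Fin d)))
    (hTr : S.IsTranslationInvariant) (hCl : S.HasClusterProperty) (k : Fin 0 → ι) (k' : Fin m → ι)
    (F : 𝓢((Fin 0 → EuclideanSpace ℝ (Fin d)), ℂ)) (G : 𝓢((Fin m → EuclideanSpace ℝ (Fin d)), ℂ))
    (hF : IsTimeOrdered F) (hG : IsTimeOrdered G) {a : EuclideanSpace ℝ (Fin d)} (ha0 : a 0 = 0)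
    (ha : a ≠ 0) {t : ℝ} (ht : 0 ≤ t) :
    S (0 + m) (Fin.append (k ∘ Fin.rev) k')
        ((osAdjoint F).appendTensor (translateMulti (EuclideanSpace.single 0 t) G)) -
      S 0 (k ∘ Fin.rev) (osAdjoint F) * S m k' G = 0 := by
  set Gt := translateMulti (EuclideanSpace.single (0 : Fin d) t) G
  have hGt : IsTimeOrdered Gt := OSReconstructionNoE1.isTimeOrdered_translateMulti hG (by simp [ht])
  have hX : IsOffDiagonal ((osAdjoint F).appendTensor Gt) :=
    OSReconstructionNoE1.isOffDiagonal_appendTensor_osAdjoint hF hGt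
  have hE4 := hCl 0 m k k' F Gt hF hGt a ha0 ha
    (fun s => (osAdjoint F).appendTensor (translateMulti (s • a) Gt))
    (fun s => isAppendTensorOf_appendTensor _ _)
  have hconst : ∀ s : ℝ, S (0 + m) (Fin.append (k ∘ Fin.rev) k')
      ((osAdjoint F).appendTensor (translateMulti (s • a) Gt)) =
      S (0 + m) (Fin.append (k ∘ Fin.rev) k') ((osAdjoint F).appendTensor Gt) := by
    intro s
    have h1 : (osAdjoint F).appendTensor (translateMulti (s • a) Gt) =
        translateMulti (s • a) ((osAdjoint F).appendTensor Gt) := by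
      rw [translateMulti_appendTensor, translateMulti_of_isEmpty (s • a) (osAdjoint F)]
    rw [h1]
    exact hTr (0 + m) _ (s • a) _ hX
  simp_rw [hconst] at hE4
  rw [← hTr m k' (EuclideanSpace.single (0 : Fin d) t) G hG.isOffDiagonal]
  exact tendsto_nhds_unique tendsto_const_nhds hE4

/-- **Degree zero, right slot, no E1.** For `G` in no variable:
`𝔖_{n+0}(ΘF* ⊗ T_t G) = 𝔖ₙ(ΘF*) 𝔖₀(G)` (E4 along a spatial direction, constant sequence). -/
theorem truncated_eq_zero_right_noE1 (S : LabelledSchwingerFamily ι (EuclideanSpace ℝ (Fin d)))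
    (hCl : S.HasClusterProperty) (k : Fin n → ι) (k' : Fin 0 → ι)
    (F : 𝓢((Fin n → EuclideanSpace ℝ (Fin d)), ℂ)) (G : 𝓢((Fin 0 → EuclideanSpace ℝ (Fin d)), ℂ))
    (hF : IsTimeOrdered F) (hG : IsTimeOrdered G) {a : EuclideanSpace ℝ (Fin d)} (ha0 : a 0 = 0)
    (ha : a ≠ 0) (t : ℝ) :
    S (n + 0) (Fin.append (k ∘ Fin.rev) k')
        ((osAdjoint F).appendTensor (translateMulti (EuclideanSpace.single 0 t) G)) -
      S n (k ∘ Fin.rev) (osAdjoint F) * S 0 k' G = 0 := by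
  rw [translateMulti_of_isEmpty]
  have hE4 := hCl n 0 k k' F G hF hG a ha0 ha
    (fun s => (osAdjoint F).appendTensor (translateMulti (s • a) G))
    (fun s => isAppendTensorOf_appendTensor _ _)
  simp_rw [translateMulti_of_isEmpty] at hE4
  exact tendsto_nhds_unique tendsto_const_nhds hE4

/-! ## The Cauchy–Schwarz bound on the spans of slab-ordered product tensors suffices -/

/-- **Full-spectrum gap from the Cauchy–Schwarz bound on the spans, no E1** (`d ≥ 2`).  If for all
`n, m ≥ 1`, all label strings and all `F ∈ span(slabOrderedProducts d n)`,
`G ∈ span(slabOrderedProducts d m)`, `t ≥ 0`,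
`‖𝔖_{n+m}(ΘF* ⊗ T_t G) − 𝔖ₙ(ΘF*) 𝔖ₘ(G)‖ ≤ e^{−Δt} √‖𝔖₂ₙ(ΘF* ⊗ F)‖ √‖𝔖₂ₘ(ΘG* ⊗ G)‖`,
then `S.HasMassGap Δ`: both sides are continuous in `(F, G)` at fixed `t` and the spans are dense in
the time-ordered test functions (ordered-wedge density); degree `0` by
`truncated_eq_zero_left/right_noE1`. -/
theorem hasMassGap_of_csBound_span_noE1 (S : LabelledSchwingerFamily ι (EuclideanSpace ℝ (Fin d)))
    (hTr : S.IsTranslationInvariant) (hCl : S.HasClusterProperty) (hd : 1 < d) (Δ : ℝ)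
    (h : ∀ (n m : ℕ), n ≠ 0 → m ≠ 0 → ∀ (k : Fin n → ι) (k' : Fin m → ι)
      (F : 𝓢((Fin n → EuclideanSpace ℝ (Fin d)), ℂ)) (G : 𝓢((Fin m → EuclideanSpace ℝ (Fin d)), ℂ)),
      F ∈ Submodule.span ℂ (slabOrderedProducts d n) →
      G ∈ Submodule.span ℂ (slabOrderedProducts d m) → ∀ t : ℝ, 0 ≤ t →
        ‖S (n + m) (Fin.append (k ∘ Fin.rev) k')
              ((osAdjoint F).appendTensor (translateMulti (EuclideanSpace.single 0 t) G)) -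
            S n (k ∘ Fin.rev) (osAdjoint F) * S m k' G‖ ≤
          Real.exp (-Δ * t) *
            Real.sqrt ‖S (n + n) (Fin.append (k ∘ Fin.rev) k) ((osAdjoint F).appendTensor F)‖ *
            Real.sqrt ‖S (m + m) (Fin.append (k' ∘ Fin.rev) k') ((osAdjoint G).appendTensor G)‖) :
    S.HasMassGap Δ := by
  intro n m k k' F G hF hG
  let Φ : 𝓢((Fin n → EuclideanSpace ℝ (Fin d)), ℂ) → 𝓢((Fin m → EuclideanSpace ℝ (Fin d)), ℂ) →
      ℝ → ℂ := fun P Q t =>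
    S (n + m) (Fin.append (k ∘ Fin.rev) k')
        ((osAdjoint P).appendTensor (translateMulti (EuclideanSpace.single 0 t) Q)) -
      S n (k ∘ Fin.rev) (osAdjoint P) * S m k' Q
  let Nn : 𝓢((Fin n → EuclideanSpace ℝ (Fin d)), ℂ) → ℝ := fun P =>
    Real.sqrt ‖S (n + n) (Fin.append (k ∘ Fin.rev) k) ((osAdjoint P).appendTensor P)‖
  let Nm : 𝓢((Fin m → EuclideanSpace ℝ (Fin d)), ℂ) → ℝ := fun Q =>
    Real.sqrt ‖S (m + m) (Fin.append (k' ∘ Fin.rev) k') ((osAdjoint Q).appendTensor Q)‖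
  refine ⟨Nn F * Nm G, fun t ht H hH => ?_⟩
  rw [eq_appendTensor_of_isAppendTensorOf' hH]
  change ‖Φ F G t‖ ≤ Nn F * Nm G * Real.exp (-Δ * t)
  have hRHS : 0 ≤ Nn F * Nm G * Real.exp (-Δ * t) :=
    mul_nonneg (mul_nonneg (Real.sqrt_nonneg _) (Real.sqrt_nonneg _)) (Real.exp_pos _).le
  -- degree zero in either slot (spatial direction `e₁`)
  have ha0 :
      (EuclideanSpace.single (⟨1, hd⟩ : Fin d) (1 : ℝ) : EuclideanSpace ℝ (Fin d)) 0 = 0 := by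
    have h10 : (0 : Fin d) ≠ ⟨1, hd⟩ := fun h => absurd (congrArg Fin.val h) (by simp)
    simp [h10]
  have ha : (EuclideanSpace.single (⟨1, hd⟩ : Fin d) (1 : ℝ) : EuclideanSpace ℝ (Fin d)) ≠ 0 :=
    fun h => by simpa using congrArg (fun v : EuclideanSpace ℝ (Fin d) => v ⟨1, hd⟩) h
  rcases Nat.eq_zero_or_pos n with rfl | hn
  · have h0 : Φ F G t = 0 := truncated_eq_zero_left_noE1 S hTr hCl k k' F G hF hG ha0 ha ht
    rw [h0, norm_zero]; exact hRHS
  rcases Nat.eq_zero_or_pos m with rfl | hm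
  · have h0 : Φ F G t = 0 := truncated_eq_zero_right_noE1 S hCl k k' F G hF hG ha0 ha t
    rw [h0, norm_zero]; exact hRHS
  -- density: both sides are continuous in the pair, the bound holds on span × span
  have hΦc : Continuous fun pq : 𝓢((Fin n → EuclideanSpace ℝ (Fin d)), ℂ) ×
      𝓢((Fin m → EuclideanSpace ℝ (Fin d)), ℂ) => Φ pq.1 pq.2 t := by
    refine Continuous.sub ?_ (Continuous.mul ?_ ?_)
    · exact (S (n + m) (Fin.append (k ∘ Fin.rev) k')).continuous.comp
        (continuous_osAdjoint_appendTensor_translateMulti' (EuclideanSpace.single 0 t))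
    · exact (S n (k ∘ Fin.rev)).continuous.comp (continuous_osAdjoint.comp continuous_fst)
    · exact (S m k').continuous.comp continuous_snd
  have hNnc : Continuous Nn :=
    Real.continuous_sqrt.comp (continuous_norm.comp
      ((S (n + n) (Fin.append (k ∘ Fin.rev) k)).continuous.comp
        (continuous_appendTensor.comp (continuous_osAdjoint.prodMk continuous_id))))
  have hNmc : Continuous Nm :=
    Real.continuous_sqrt.comp (continuous_norm.comp
      ((S (m + m) (Fin.append (k' ∘ Fin.rev) k')).continuous.comp
        (continuous_appendTensor.comp (continuous_osAdjoint.prodMk continuous_id))))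
  have hclosed : IsClosed {pq : 𝓢((Fin n → EuclideanSpace ℝ (Fin d)), ℂ) ×
      𝓢((Fin m → EuclideanSpace ℝ (Fin d)), ℂ) |
        ‖Φ pq.1 pq.2 t‖ ≤ Nn pq.1 * Nm pq.2 * Real.exp (-Δ * t)} :=
    isClosed_le (continuous_norm.comp hΦc)
      (((hNnc.comp continuous_fst).mul (hNmc.comp continuous_snd)).mul continuous_const)
  have hsub : ((Submodule.span ℂ (slabOrderedProducts d n) :
        Set 𝓢((Fin n → EuclideanSpace ℝ (Fin d)), ℂ)) ×ˢ
      (Submodule.span ℂ (slabOrderedProducts d m) :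
        Set 𝓢((Fin m → EuclideanSpace ℝ (Fin d)), ℂ))) ⊆
      {pq | ‖Φ pq.1 pq.2 t‖ ≤ Nn pq.1 * Nm pq.2 * Real.exp (-Δ * t)} := by
    intro pq hpq
    have := h n m hn.ne' hm.ne' k k' pq.1 pq.2 hpq.1 hpq.2 t ht
    simp only [Set.mem_setOf_eq, Φ, Nn, Nm]
    linarith [this]
  have hmem : (F, G) ∈ closure (((Submodule.span ℂ (slabOrderedProducts d n) :
        Set 𝓢((Fin n → EuclideanSpace ℝ (Fin d)), ℂ)) ×ˢ
      (Submodule.span ℂ (slabOrderedProducts d m) :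
        Set 𝓢((Fin m → EuclideanSpace ℝ (Fin d)), ℂ)))) := by
    rw [closure_prod_eq]
    exact ⟨hF.mem_closure_span_slabOrderedProducts, hG.mem_closure_span_slabOrderedProducts⟩
  simpa only [Set.mem_setOf_eq] using hclosed.closure_subset_iff.2 hsub hmem

/-! ## The full-spectrum gap from diagonal bounds with free constants -/

/-- **Full-spectrum gap from DIAGONAL bounds with FREE constants, no E1** (`d ≥ 2`).  If for every
arity `n ≥ 1`, every label string `k` and every slab-ordered real product tensor `P` there is SOME
constant `C` with `‖𝔖₂ₙ^{rev k ++ k}(ΘP* ⊗ T_t P) − 𝔖ₙ^{rev k}(ΘP*) 𝔖ₙ^{k}(P)‖ ≤ C e^{−Δt}` for all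
`t ≥ 0`, then `S.HasMassGap Δ`.  In the OS Hilbert space of `S` (reflection positivity +
translations, `OSReconstructionNoE1`) the diagonal quantity is `⟨v, e^{−tH} v⟩` for the
vacuum-projected field vector `v = Ψ_P − ⟨Ω,Ψ_P⟩Ω`; log-convexity with infinite horizon
self-improves the constant to `‖v‖²`, the improved bound passes to the span, Cauchy–Schwarz gives
`|⟨v, e^{−tH} w⟩| ≤ e^{−Δt}‖Ψ_F‖‖Ψ_G‖`, and `hasMassGap_of_csBound_span_noE1` concludes. -/
theorem hasMassGap_of_diagBound_noE1 (S : LabelledSchwingerFamily ι (EuclideanSpace ℝ (Fin d)))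
    (hN : S.IsNormalized) (hTr : S.IsTranslationInvariant) (hRP : S.IsReflectionPositive)
    (hCl : S.HasClusterProperty) (hd : 1 < d) (Δ : ℝ)
    (hdiag : ∀ (n : ℕ), n ≠ 0 → ∀ (k : Fin n → ι) (P : 𝓢((Fin n → EuclideanSpace ℝ (Fin d)), ℂ)),
      P ∈ slabOrderedProducts d n → ∃ C : ℝ, ∀ t : ℝ, 0 ≤ t →
        ‖S (n + n) (Fin.append (k ∘ Fin.rev) k)
              ((osAdjoint P).appendTensor (translateMulti (EuclideanSpace.single 0 t) P)) -
            S n (k ∘ Fin.rev) (osAdjoint P) * S n k P‖ ≤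
          C * Real.exp (-Δ * t)) :
    S.HasMassGap Δ := by
  have hOS : OSReconstructionNoE1 S := ⟨hRP, hTr⟩
  -- (1) the vacuum-projected field vector of ONE slab-ordered real product tensor obeys the
  --     improved bound (self-improvement of the free constant)
  have hgood : ∀ (n : ℕ), n ≠ 0 → ∀ (k : Fin n → ι)
      (P : 𝓢((Fin n → EuclideanSpace ℝ (Fin d)), ℂ)) (hP : P ∈ slabOrderedProducts d n) (t : ℝ),
      0 ≤ t →
      (⟪hOS.fieldVec n k P (IsTimeOrdered.of_mem_slabOrderedProducts hP) -
            ⟪hOS.vacuum, hOS.fieldVec n k P (IsTimeOrdered.of_mem_slabOrderedProducts hP)⟫_ℂ •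
              hOS.vacuum,
          hOS.transfer t
            (hOS.fieldVec n k P (IsTimeOrdered.of_mem_slabOrderedProducts hP) -
              ⟪hOS.vacuum, hOS.fieldVec n k P (IsTimeOrdered.of_mem_slabOrderedProducts hP)⟫_ℂ •
                hOS.vacuum)⟫_ℂ).re ≤
        ‖hOS.fieldVec n k P (IsTimeOrdered.of_mem_slabOrderedProducts hP) -
            ⟪hOS.vacuum, hOS.fieldVec n k P (IsTimeOrdered.of_mem_slabOrderedProducts hP)⟫_ℂ •
              hOS.vacuum‖ ^ 2 * Real.exp (-Δ * t) := by
    intro n hn k P hP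
    obtain ⟨C, hC⟩ := hdiag n hn k P hP
    have hPt : IsTimeOrdered P := IsTimeOrdered.of_mem_slabOrderedProducts hP
    refine fun t ht => hOS.re_inner_transfer_self_le_of_le_exp (C := C) (fun s hs => ?_) ht
    rw [hOS.inner_proj_transfer_proj hN, hOS.inner_fieldVec_transfer_fieldVec k k hPt hPt hs,
      hOS.inner_fieldVec_vacuum, hOS.inner_vacuum_fieldVec]
    exact (le_abs_self _).trans ((Complex.abs_re_le_norm _).trans (hC s hs))
  -- (2) the Cauchy–Schwarz bound on span × span
  refine hasMassGap_of_csBound_span_noE1 S hTr hCl hd Δ fun n m hn hm k k' F G hF hG t ht => ?_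
  obtain ⟨N, c, g, rfl⟩ := Submodule.mem_span_set'.1 hF
  obtain ⟨N', c', g', rfl⟩ := Submodule.mem_span_set'.1 hG
  have hPi : ∀ i, IsTimeOrdered (g i : 𝓢((Fin n → EuclideanSpace ℝ (Fin d)), ℂ)) := fun i =>
    IsTimeOrdered.of_mem_slabOrderedProducts (g i).2
  have hQj : ∀ j, IsTimeOrdered (g' j : 𝓢((Fin m → EuclideanSpace ℝ (Fin d)), ℂ)) := fun j =>
    IsTimeOrdered.of_mem_slabOrderedProducts (g' j).2
  -- the OS vectors of `F = ∑ cᵢ Pᵢ` and `G = ∑ c'ⱼ Qⱼ`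
  set V : hOS.Hilbert := ∑ i, c i • hOS.fieldVec n k (g i) (hPi i) with hV
  set W : hOS.Hilbert := ∑ j, c' j • hOS.fieldVec m k' (g' j) (hQj j) with hW
  clear_value V W
  -- (3) matrix elements of `V, W` are the Schwinger functions of `F, G`
  have hVW : ⟪V, hOS.transfer t W⟫_ℂ = S (n + m) (Fin.append (k ∘ Fin.rev) k')
      ((osAdjoint (∑ i, c i • (g i : 𝓢((Fin n → EuclideanSpace ℝ (Fin d)), ℂ)))).appendTensor
        (translateMulti (EuclideanSpace.single 0 t)
          (∑ j, c' j • (g' j : 𝓢((Fin m → EuclideanSpace ℝ (Fin d)), ℂ))))) := by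
    rw [map_sum (translateMulti (EuclideanSpace.single (0 : Fin d) t)),
      Finset.sum_congr rfl fun j _ =>
        map_smul (translateMulti (EuclideanSpace.single (0 : Fin d) t)) _ _,
      apply_osAdjoint_appendTensor_sum_smul, hV, hW, map_sum (hOS.transfer t), sum_inner]
    refine Finset.sum_congr rfl fun i _ => ?_
    rw [inner_sum]
    refine Finset.sum_congr rfl fun j _ => ?_
    rw [map_smul, inner_smul_left, inner_smul_right,
      hOS.inner_fieldVec_transfer_fieldVec k k' (hPi i) (hQj j) ht]
    ring
  have hVΩ : ⟪V, hOS.vacuum⟫_ℂ = S n (k ∘ Fin.rev)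
      (osAdjoint (∑ i, c i • (g i : 𝓢((Fin n → EuclideanSpace ℝ (Fin d)), ℂ)))) := by
    rw [apply_osAdjoint_sum_smul, hV, sum_inner]
    refine Finset.sum_congr rfl fun i _ => ?_
    rw [inner_smul_left, hOS.inner_fieldVec_vacuum k (hPi i)]
  have hΩW : ⟪hOS.vacuum, W⟫_ℂ = S m k'
      (∑ j, c' j • (g' j : 𝓢((Fin m → EuclideanSpace ℝ (Fin d)), ℂ))) := by
    rw [apply_sum_smul, hW, inner_sum]
    refine Finset.sum_congr rfl fun j _ => ?_
    rw [inner_smul_right, hOS.inner_vacuum_fieldVec k' (hQj j)]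
  have hVV : ⟪V, V⟫_ℂ = S (n + n) (Fin.append (k ∘ Fin.rev) k)
      ((osAdjoint (∑ i, c i • (g i : 𝓢((Fin n → EuclideanSpace ℝ (Fin d)), ℂ)))).appendTensor
        (∑ i, c i • (g i : 𝓢((Fin n → EuclideanSpace ℝ (Fin d)), ℂ)))) := by
    rw [apply_osAdjoint_appendTensor_sum_smul, hV, sum_inner]
    refine Finset.sum_congr rfl fun i _ => ?_
    rw [inner_sum]
    refine Finset.sum_congr rfl fun i' _ => ?_
    rw [inner_smul_left, inner_smul_right, hOS.inner_fieldVec_fieldVec_same k (hPi i) (hPi i')]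
    ring
  have hWW : ⟪W, W⟫_ℂ = S (m + m) (Fin.append (k' ∘ Fin.rev) k')
      ((osAdjoint (∑ j, c' j • (g' j : 𝓢((Fin m → EuclideanSpace ℝ (Fin d)), ℂ)))).appendTensor
        (∑ j, c' j • (g' j : 𝓢((Fin m → EuclideanSpace ℝ (Fin d)), ℂ)))) := by
    rw [apply_osAdjoint_appendTensor_sum_smul, hW, sum_inner]
    refine Finset.sum_congr rfl fun j _ => ?_
    rw [inner_sum]
    refine Finset.sum_congr rfl fun j' _ => ?_
    rw [inner_smul_left, inner_smul_right, hOS.inner_fieldVec_fieldVec_same k' (hQj j) (hQj j')]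
    ring
  have hnV : Real.sqrt ‖S (n + n) (Fin.append (k ∘ Fin.rev) k)
      ((osAdjoint (∑ i, c i • (g i : 𝓢((Fin n → EuclideanSpace ℝ (Fin d)), ℂ)))).appendTensor
        (∑ i, c i • (g i : 𝓢((Fin n → EuclideanSpace ℝ (Fin d)), ℂ))))‖ = ‖V‖ := by
    rw [← hVV, inner_self_eq_norm_sq_to_K, norm_pow, RCLike.norm_ofReal, abs_norm,
      Real.sqrt_sq (norm_nonneg _)]
  have hnW : Real.sqrt ‖S (m + m) (Fin.append (k' ∘ Fin.rev) k')
      ((osAdjoint (∑ j, c' j • (g' j : 𝓢((Fin m → EuclideanSpace ℝ (Fin d)), ℂ)))).appendTensor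
        (∑ j, c' j • (g' j : 𝓢((Fin m → EuclideanSpace ℝ (Fin d)), ℂ))))‖ = ‖W‖ := by
    rw [← hWW, inner_self_eq_norm_sq_to_K, norm_pow, RCLike.norm_ofReal, abs_norm,
      Real.sqrt_sq (norm_nonneg _)]
  -- (4) the vacuum-projected vectors lie in the span of the projected `Ψᵢ`, hence are good
  have hpV : V - ⟪hOS.vacuum, V⟫_ℂ • hOS.vacuum = ∑ i, c i •
      (hOS.fieldVec n k (g i) (hPi i) - ⟪hOS.vacuum, hOS.fieldVec n k (g i) (hPi i)⟫_ℂ •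
        hOS.vacuum) := by
    rw [hV]
    simp only [inner_sum, inner_smul_right, Finset.sum_smul, smul_sub, smul_smul,
      Finset.sum_sub_distrib]
  have hpW : W - ⟪hOS.vacuum, W⟫_ℂ • hOS.vacuum = ∑ j, c' j •
      (hOS.fieldVec m k' (g' j) (hQj j) - ⟪hOS.vacuum, hOS.fieldVec m k' (g' j) (hQj j)⟫_ℂ •
        hOS.vacuum) := by
    rw [hW]
    simp only [inner_sum, inner_smul_right, Finset.sum_smul, smul_sub, smul_smul,
      Finset.sum_sub_distrib]
  have hgoodV : ∀ s : ℝ, 0 ≤ s →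
      (⟪V - ⟪hOS.vacuum, V⟫_ℂ • hOS.vacuum,
          hOS.transfer s (V - ⟪hOS.vacuum, V⟫_ℂ • hOS.vacuum)⟫_ℂ).re ≤
        ‖V - ⟪hOS.vacuum, V⟫_ℂ • hOS.vacuum‖ ^ 2 * Real.exp (-Δ * s) := by
    rw [hpV]
    exact fun s hs => hOS.re_inner_transfer_self_le_sum c
      (fun i => hOS.fieldVec n k (g i) (hPi i) -
        ⟪hOS.vacuum, hOS.fieldVec n k (g i) (hPi i)⟫_ℂ • hOS.vacuum)
      (fun i => hgood n hn k _ (g i).2) hs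
  have hgoodW : ∀ s : ℝ, 0 ≤ s →
      (⟪W - ⟪hOS.vacuum, W⟫_ℂ • hOS.vacuum,
          hOS.transfer s (W - ⟪hOS.vacuum, W⟫_ℂ • hOS.vacuum)⟫_ℂ).re ≤
        ‖W - ⟪hOS.vacuum, W⟫_ℂ • hOS.vacuum‖ ^ 2 * Real.exp (-Δ * s) := by
    rw [hpW]
    exact fun s hs => hOS.re_inner_transfer_self_le_sum c'
      (fun j => hOS.fieldVec m k' (g' j) (hQj j) -
        ⟪hOS.vacuum, hOS.fieldVec m k' (g' j) (hQj j)⟫_ℂ • hOS.vacuum)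
      (fun j => hgood m hm k' _ (g' j).2) hs
  -- (5) Cauchy–Schwarz for the projected vectors, and `‖v‖ ≤ ‖Ψ‖`
  have hid : ⟪V - ⟪hOS.vacuum, V⟫_ℂ • hOS.vacuum,
      hOS.transfer t (W - ⟪hOS.vacuum, W⟫_ℂ • hOS.vacuum)⟫_ℂ =
      S (n + m) (Fin.append (k ∘ Fin.rev) k')
          ((osAdjoint (∑ i, c i • (g i : 𝓢((Fin n → EuclideanSpace ℝ (Fin d)), ℂ)))).appendTensor
            (translateMulti (EuclideanSpace.single 0 t)
              (∑ j, c' j • (g' j : 𝓢((Fin m → EuclideanSpace ℝ (Fin d)), ℂ))))) -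
        S n (k ∘ Fin.rev)
            (osAdjoint (∑ i, c i • (g i : 𝓢((Fin n → EuclideanSpace ℝ (Fin d)), ℂ)))) *
          S m k' (∑ j, c' j • (g' j : 𝓢((Fin m → EuclideanSpace ℝ (Fin d)), ℂ))) := by
    rw [hOS.inner_proj_transfer_proj hN, hVW, hVΩ, hΩW]
  have key := hOS.norm_inner_transfer_le_of_le_exp hgoodV hgoodW ht
  rw [hid] at key
  rw [hnV, hnW]
  calc _ ≤ Real.exp (-Δ * t) * ‖V - ⟪hOS.vacuum, V⟫_ℂ • hOS.vacuum‖ *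
        ‖W - ⟪hOS.vacuum, W⟫_ℂ • hOS.vacuum‖ := key
    _ ≤ Real.exp (-Δ * t) * ‖V‖ * ‖W‖ := by
        have hE : 0 ≤ Real.exp (-Δ * t) := (Real.exp_pos _).le
        have h1 := hOS.norm_sub_inner_vacuum_smul_le hN V
        have h2 := hOS.norm_sub_inner_vacuum_smul_le hN W
        exact mul_le_mul (mul_le_mul_of_nonneg_left h1 hE) h2 (norm_nonneg _) (by positivity)

/-! ## Lattice-facing form: diagonal clustering of a lattice approximation, free constants -/

/-- **The transfer from a lattice approximation, diagonal form, no E1.**  If `Λ k → 𝔖` on the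
off-diagonal real product tensors of every degree `n ≥ 1` and for every arity `n ≥ 1`, label string
`σ` and ONE slab-ordered real factor datum `p` there is a constant `C` such that for all `t ≥ 0` and
`ε > 0`, EVENTUALLY in `k`, `‖Λᵏ₂ₙ(θpʳ ++ T_t p) − Λᵏₙ(θpʳ) Λᵏₙ(p)‖ ≤ C e^{−Δt} + ε`
(i.e. `ClustersDiag d Λ Δ`), then `S.HasMassGap Δ` (`d ≥ 2`): termwise limits, `ε → 0`, then
`hasMassGap_of_diagBound_noE1`. -/
theorem hasMassGap_of_tendsto_of_diagBound_noE1
    (S : LabelledSchwingerFamily ι (EuclideanSpace ℝ (Fin d)))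
    (hN : S.IsNormalized) (hTr : S.IsTranslationInvariant) (hRP : S.IsReflectionPositive)
    (hCl : S.HasClusterProperty) (hd : 1 < d)
    (Λ : ℕ → (n : ℕ) → (Fin n → ι) → (Fin n → 𝓢(EuclideanSpace ℝ (Fin d), ℝ)) → ℂ)
    (hΛ : ∀ (n : ℕ), n ≠ 0 → ∀ (σ : Fin n → ι) (f : Fin n → 𝓢(EuclideanSpace ℝ (Fin d), ℝ))
      (F : 𝓢((Fin n → EuclideanSpace ℝ (Fin d)), ℂ)), IsTensorOf F (fun i => ofRealTest (f i)) →
      IsOffDiagonal F → Tendsto (fun k => Λ k n σ f) atTop (𝓝 (S n σ F)))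
    {Δ : ℝ} (hdiag : ClustersDiag d Λ Δ) : S.HasMassGap Δ := by
  refine hasMassGap_of_diagBound_noE1 S hN hTr hRP hCl hd Δ fun n hn σ P hP => ?_
  obtain ⟨p, hpT, hp⟩ := exists_isSlabOrdered_of_mem_slabOrderedProducts hP
  obtain ⟨C, hC⟩ := hdiag n hn σ p hp
  have hPt : IsTimeOrdered P := IsTimeOrdered.of_mem_slabOrderedProducts hP
  refine ⟨C, fun t ht => ?_⟩
  set a : EuclideanSpace ℝ (Fin d) := EuclideanSpace.single 0 t with ha
  -- the three lattice quantities converge to their continuum counterparts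
  have hA : Tendsto (fun k => Λ k (n + n) (Fin.append (σ ∘ Fin.rev) σ)
        (Fin.append (fun l => thetaTest d (p (Fin.rev l))) (fun l => translateTest a (p l))))
      atTop (𝓝 (S (n + n) (Fin.append (σ ∘ Fin.rev) σ)
        ((osAdjoint P).appendTensor (translateMulti a P)))) := by
    refine hΛ (n + n) (by omega) _ _ _ ?_ ?_
    · have h1 := hpT.osAdjoint.appendTensor (hpT.translateMulti a)
      rwa [append_ofRealTest] at h1
    · exact OSReconstructionNoE1.isOffDiagonal_appendTensor_osAdjoint hPt
        (OSReconstructionNoE1.isTimeOrdered_translateMulti hPt (by simp [ha, ht]))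
  have hB : Tendsto (fun k => Λ k n (σ ∘ Fin.rev) (fun l => thetaTest d (p (Fin.rev l))))
      atTop (𝓝 (S n (σ ∘ Fin.rev) (osAdjoint P))) :=
    hΛ n hn _ _ _ hpT.osAdjoint hPt.isOffDiagonal.osAdjoint
  have hC' : Tendsto (fun k => Λ k n σ p) atTop (𝓝 (S n σ P)) :=
    hΛ n hn _ _ _ hpT hPt.isOffDiagonal
  have hlim := (hA.sub (hB.mul hC')).norm
  refine le_of_forall_pos_le_add fun ε hε => ?_
  exact le_of_tendsto_of_tendsto hlim tendsto_const_nhds (hC t ht ε hε)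

/-- (S4) **Gap transfer to a labelled limit without E1.**  For a labelled family `S` of the QCD
species on `ℝ⁴` that is E0-normalised, translation invariant on `⁰𝒮`, reflection positive and
clustering, the convergence of the lattice QCD `n`-point functions `qcdLatticeSchwinger sch k` to
`S` on off-diagonal real product tensors together with species diagonal clustering
`sch.HasSpeciesDiagClustering Δ` (= `ClustersDiag 4 (qcdLatticeSchwinger sch) Δ`) gives the
full-spectrum continuum gap `S.HasMassGap Δ` (`hasMassGap_of_tendsto_of_diagBound_noE1` at
`d = 4`). -/
theorem stub_gapTransfer : ∀ (Nf : ℕ) (sch : QCDScheme Nf) (Δ : ℝ) (S : LabelledSchwingerFamily (QCDField Nf) (EuclideanSpace ℝ (Fin 4))), S.IsNormalized → S.IsTranslationInvariant → S.IsReflectionPositive → S.HasClusterProperty → (∀ n : ℕ, n ≠ 0 → ∀ (σ : Fin n → QCDField Nf) (f : Fin n → SchwartzMap (EuclideanSpace ℝ (Fin 4)) ℝ) (F : SchwartzMap (Fin n → EuclideanSpace ℝ (Fin 4)) ℂ), IsTensorOf F (fun i => ofRealTest (f i)) → IsOffDiagonal F → Filter.Tendsto (fun k : ℕ => qcdLatticeSchwinger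 sch k n σ f) Filter.atTop (nhds (S n σ F))) → sch.HasSpeciesDiagClustering Δ → S.HasMassGap Δ := by
  intro Nf sch Δ S hN hTr hRP hCl hLim hDiag
  exact hasMassGap_of_tendsto_of_diagBound_noE1 S hN hTr hRP hCl (by norm_num)
    (qcdLatticeSchwinger sch) hLim hDiag

end Summit.QuantumFields.QCD.Theorems.ConvergentOSClosure

end
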